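import Mathlib
import HarnessLib
import Literature.AlgebraicGeometry.HyperbolicPolynomials.SpectrahedralShadow
import Summits.ValiantsHypothesis.ValiantsHypothesis.Theorems.PermanentalConesHyperbolicVPShadowStubSpectrahedronOfSymmDetIdentity

/-!
# ValiantsHypothesis / PermanentalCones — `HyperbolicVPShadow`, stub Tʰ

Route `PermanentalCones`, item `stmt-ValiantsHypothesis-8655` (crux `HyperbolicVPShadow`), line
`birth`, stub `stub_oshimeFamilyTh_spectrahedron` (Oshime's Jordan-block family (T) of
non-symmetrisable real-spectrum `3 × 3` pencils, homogenised, has size-`3` spectrahedral cones).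

Oshime (J. Math. Kyoto Univ. 31 (1991), part (II), Prop. 4.6 / Thm. 6.2) lists the family (T)
of linear pencils of real `3 × 3` matrices `x₀·1 + x₁ A + x₂ B + x₃ C` with
`A = J₃ = E₁₂ + E₂₃`, `B = !![0, e₂, −e₃; −1, e₁, 0; 0, 1, 0]` (`e₁, e₂, e₃` the elementary
symmetric functions of `s₁ < s₂ < s₃`) and `C = b₀ · !![0, b₁ + b₂, −b₁ b₂; 0, 1, 0; 0, 0, 0]`;
it has only real eigenvalues iff `s₁ ≤ b₁ ≤ s₂ ≤ b₂ ≤ s₃` (interlacing). We show that then its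
closed nonnegative-spectrum cone `{x : ∀ τ > 0, det (P x + τ·1) ≠ 0}` is a spectrahedron of
size `3`.

## Proof

* (F1) `det (t·1 + x J₃ + y B + z C) = (t + s₁ y)(t + s₂ y)(t + s₃ y) + b₀ z (t + b₁ y)(t + b₂ y)`
  does not depend on `x` (cofactor expansion).
* (F2) The *real symmetric* certificate is `L x = x₀·1 + x₂ diag (s₁, s₂, s₃) + x₃ b₀ c cᵀ` with
  `cᵢ² = κᵢ`, the Lagrange coefficients `κ₁ = (b₁ − s₁)(b₂ − s₁) / ((s₂ − s₁)(s₃ − s₁))`, …,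
  which are nonnegative exactly because of the interlacing.
* (F3) `det (L x + τ·1) = ∏ᵢ (t + sᵢ y) + b₀ z ∑ᵢ cᵢ² ∏_{j ≠ i} (t + sⱼ y)` (matrix determinant
  lemma, here by cofactor expansion), `t = τ + x₀`, `y = x₂`, `z = x₃`.
* (F4) Lagrange interpolation: `∑ᵢ κᵢ ∏_{j ≠ i} (t + sⱼ y) = (t + b₁ y)(t + b₂ y)`.

Hence `det (P x + τ·1) = det (L x + τ·1)` identically, and
`stub_spectrahedron_of_symmDetIdentity` (stub S) turns this into a size-`3` spectrahedral
description. No definitions are introduced: all matrices are literals, the two pencils are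
`Fintype.linearCombination ℝ ![…]`.
-/

-- `<Problem> = <Summit>` for this single-conjunct summit (lakefile sets the same option tree-wide).
set_option linter.dupNamespace false

namespace Summit.ValiantsHypothesis.ValiantsHypothesis.Theorems

open Matrix

/-! ## The Lagrange coefficients -/

/-- **(F2) Nonnegativity of the Lagrange coefficients.** Under the interlacing
`s₁ ≤ b₁ ≤ s₂ ≤ b₂ ≤ s₃`, `s₁ < s₂ < s₃`, the three coefficients
`κᵢ = (b₁ − sᵢ)(b₂ − sᵢ) / ∏_{j ≠ i} (sⱼ − sᵢ)` are nonnegative. [folklore] -/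
theorem permanentalCones_oshimeT_kappa_nonneg (s₁ s₂ s₃ b₁ b₂ : ℝ) (h12 : s₁ < s₂)
    (h23 : s₂ < s₃) (hb1 : s₁ ≤ b₁) (hb1' : b₁ ≤ s₂) (hb2 : s₂ ≤ b₂) (hb2' : b₂ ≤ s₃) :
    0 ≤ (b₁ - s₁) * (b₂ - s₁) / ((s₂ - s₁) * (s₃ - s₁)) ∧
      0 ≤ (b₁ - s₂) * (b₂ - s₂) / ((s₁ - s₂) * (s₃ - s₂)) ∧
      0 ≤ (b₁ - s₃) * (b₂ - s₃) / ((s₁ - s₃) * (s₂ - s₃)) := by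
  refine ⟨?_, ?_, ?_⟩
  · exact div_nonneg (mul_nonneg (by linarith) (by linarith))
      (mul_nonneg (by linarith) (by linarith))
  · exact div_nonneg_of_nonpos (mul_nonpos_of_nonpos_of_nonneg (by linarith) (by linarith))
      (mul_nonpos_of_nonpos_of_nonneg (by linarith) (by linarith))
  · exact div_nonneg (mul_nonneg_of_nonpos_of_nonpos (by linarith) (by linarith))
      (mul_nonneg_of_nonpos_of_nonpos (by linarith) (by linarith))

/-- **(F4) Lagrange interpolation** of the quadratic form `(t + b₁ y)(t + b₂ y)` at the nodes
`t = −sᵢ y`: `∑ᵢ κᵢ ∏_{j ≠ i} (t + sⱼ y) = (t + b₁ y)(t + b₂ y)` for distinct `s₁ < s₂ < s₃`.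
[folklore] -/
theorem permanentalCones_oshimeT_lagrange (s₁ s₂ s₃ b₁ b₂ : ℝ) (h12 : s₁ < s₂) (h23 : s₂ < s₃)
    (t y : ℝ) :
    (b₁ - s₁) * (b₂ - s₁) / ((s₂ - s₁) * (s₃ - s₁)) * ((t + s₂ * y) * (t + s₃ * y)) +
        (b₁ - s₂) * (b₂ - s₂) / ((s₁ - s₂) * (s₃ - s₂)) * ((t + s₁ * y) * (t + s₃ * y)) +
        (b₁ - s₃) * (b₂ - s₃) / ((s₁ - s₃) * (s₂ - s₃)) * ((t + s₁ * y) * (t + s₂ * y)) =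
      (t + b₁ * y) * (t + b₂ * y) := by
  have h1 : s₂ - s₁ ≠ 0 := sub_ne_zero.2 h12.ne'
  have h2 : s₃ - s₁ ≠ 0 := sub_ne_zero.2 (h12.trans h23).ne'
  have h3 : s₃ - s₂ ≠ 0 := sub_ne_zero.2 h23.ne'
  have h1' : s₁ - s₂ ≠ 0 := sub_ne_zero.2 h12.ne
  have h2' : s₁ - s₃ ≠ 0 := sub_ne_zero.2 (h12.trans h23).ne
  have h3' : s₂ - s₃ ≠ 0 := sub_ne_zero.2 h23.ne
  field_simp
  ring

/-! ## The pencil `P` and its determinant -/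

/-- Entries of `P x + τ·1 = (τ + x₀)·1 + x₁ J₃ + x₂ B + x₃ C` for the family (T). [folklore] -/
theorem permanentalCones_oshimeT_P_entries (s₁ s₂ s₃ b₀ b₁ b₂ : ℝ) (x : Fin 4 → ℝ) (τ : ℝ) :
    x 0 • (1 : Matrix (Fin 3) (Fin 3) ℝ) + x 1 • !![(0 : ℝ), 1, 0; 0, 0, 1; 0, 0, 0] +
          x 2 • !![0, s₁ * s₂ + s₂ * s₃ + s₃ * s₁, -(s₁ * s₂ * s₃); -1, s₁ + s₂ + s₃, 0; 0, 1, 0] +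
          x 3 • !![0, b₀ * (b₁ + b₂), -(b₀ * b₁ * b₂); 0, b₀, 0; 0, 0, 0] +
        τ • (1 : Matrix (Fin 3) (Fin 3) ℝ) =
      !![τ + x 0, x 1 + (s₁ * s₂ + s₂ * s₃ + s₃ * s₁) * x 2 + b₀ * (b₁ + b₂) * x 3,
          -(s₁ * s₂ * s₃) * x 2 - b₀ * b₁ * b₂ * x 3;
        -x 2, τ + x 0 + (s₁ + s₂ + s₃) * x 2 + b₀ * x 3, x 1;
        0, x 2, τ + x 0] := by
  ext i j
  fin_cases i <;> fin_cases j <;> simp <;> ring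

/-- **(F1)** `det (P x + τ·1) = (t + s₁ y)(t + s₂ y)(t + s₃ y) + b₀ z (t + b₁ y)(t + b₂ y)` with
`t = τ + x₀`, `y = x₂`, `z = x₃`; the Jordan-block coordinate `x₁` drops out. [folklore] -/
theorem permanentalCones_oshimeT_detP (s₁ s₂ s₃ b₀ b₁ b₂ : ℝ) (x : Fin 4 → ℝ) (τ : ℝ) :
    (x 0 • (1 : Matrix (Fin 3) (Fin 3) ℝ) + x 1 • !![(0 : ℝ), 1, 0; 0, 0, 1; 0, 0, 0] +
          x 2 • !![0, s₁ * s₂ + s₂ * s₃ + s₃ * s₁, -(s₁ * s₂ * s₃); -1, s₁ + s₂ + s₃, 0; 0, 1, 0] +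
          x 3 • !![0, b₀ * (b₁ + b₂), -(b₀ * b₁ * b₂); 0, b₀, 0; 0, 0, 0] +
        τ • (1 : Matrix (Fin 3) (Fin 3) ℝ)).det =
      (τ + x 0 + s₁ * x 2) * (τ + x 0 + s₂ * x 2) * (τ + x 0 + s₃ * x 2) +
        b₀ * x 3 * ((τ + x 0 + b₁ * x 2) * (τ + x 0 + b₂ * x 2)) := by
  rw [permanentalCones_oshimeT_P_entries]
  simp [det_fin_three]
  ring

/-! ## The symmetric certificate `L` and its determinant -/

/-- The certificate pencil as a linear map:
`Fintype.linearCombination ℝ ![1, 0, diag (s₁, s₂, s₃), b₀ c cᵀ] x = x₀·1 + x₂ diag (sᵢ) + x₃ b₀ c cᵀ`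
(the Jordan-block coordinate `x₁` has coefficient `0`), written out entrywise. [folklore] -/
theorem permanentalCones_oshimeT_L_apply (s₁ s₂ s₃ b₀ c₁ c₂ c₃ : ℝ) (x : Fin 4 → ℝ) :
    Fintype.linearCombination ℝ ![(1 : Matrix (Fin 3) (Fin 3) ℝ), 0,
        !![s₁, 0, 0; 0, s₂, 0; 0, 0, s₃],
        b₀ • !![c₁ * c₁, c₁ * c₂, c₁ * c₃; c₁ * c₂, c₂ * c₂, c₂ * c₃; c₁ * c₃, c₂ * c₃, c₃ * c₃]]
        x =
      !![x 0 + s₁ * x 2 + b₀ * (c₁ * c₁) * x 3, b₀ * (c₁ * c₂) * x 3, b₀ * (c₁ * c₃) * x 3;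
        b₀ * (c₁ * c₂) * x 3, x 0 + s₂ * x 2 + b₀ * (c₂ * c₂) * x 3, b₀ * (c₂ * c₃) * x 3;
        b₀ * (c₁ * c₃) * x 3, b₀ * (c₂ * c₃) * x 3, x 0 + s₃ * x 2 + b₀ * (c₃ * c₃) * x 3] := by
  ext i j
  rw [Fintype.linearCombination_apply, Fin.sum_univ_four]
  fin_cases i <;> fin_cases j <;> simp <;> ring

/-- Every value of the certificate pencil is symmetric. [folklore] -/
theorem permanentalCones_oshimeT_L_isSymm (s₁ s₂ s₃ b₀ c₁ c₂ c₃ : ℝ) (x : Fin 4 → ℝ) :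
    (!![x 0 + s₁ * x 2 + b₀ * (c₁ * c₁) * x 3, b₀ * (c₁ * c₂) * x 3, b₀ * (c₁ * c₃) * x 3;
        b₀ * (c₁ * c₂) * x 3, x 0 + s₂ * x 2 + b₀ * (c₂ * c₂) * x 3, b₀ * (c₂ * c₃) * x 3;
        b₀ * (c₁ * c₃) * x 3, b₀ * (c₂ * c₃) * x 3, x 0 + s₃ * x 2 + b₀ * (c₃ * c₃) * x 3] :
      Matrix (Fin 3) (Fin 3) ℝ).IsSymm :=
  Matrix.IsSymm.ext fun i j => by fin_cases i <;> fin_cases j <;> simp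

/-- **(F3) Matrix determinant lemma** for `diag (t + sᵢ y) + b₀ z c cᵀ`:
`det (L x + τ·1) = ∏ᵢ (t + sᵢ y) + b₀ z ∑ᵢ cᵢ² ∏_{j ≠ i} (t + sⱼ y)` (`t = τ + x₀`, `y = x₂`,
`z = x₃`; by cofactor expansion, the `c⁴` and `c⁶` terms cancel). [folklore] -/
theorem permanentalCones_oshimeT_detL (s₁ s₂ s₃ b₀ c₁ c₂ c₃ : ℝ) (x : Fin 4 → ℝ) (τ : ℝ) :
    ((!![x 0 + s₁ * x 2 + b₀ * (c₁ * c₁) * x 3, b₀ * (c₁ * c₂) * x 3, b₀ * (c₁ * c₃) * x 3;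
          b₀ * (c₁ * c₂) * x 3, x 0 + s₂ * x 2 + b₀ * (c₂ * c₂) * x 3, b₀ * (c₂ * c₃) * x 3;
          b₀ * (c₁ * c₃) * x 3, b₀ * (c₂ * c₃) * x 3, x 0 + s₃ * x 2 + b₀ * (c₃ * c₃) * x 3] :
          Matrix (Fin 3) (Fin 3) ℝ) + τ • (1 : Matrix (Fin 3) (Fin 3) ℝ)).det =
      (τ + x 0 + s₁ * x 2) * (τ + x 0 + s₂ * x 2) * (τ + x 0 + s₃ * x 2) +
        b₀ * x 3 *
          (c₁ ^ 2 * ((τ + x 0 + s₂ * x 2) * (τ + x 0 + s₃ * x 2)) +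
            c₂ ^ 2 * ((τ + x 0 + s₁ * x 2) * (τ + x 0 + s₃ * x 2)) +
            c₃ ^ 2 * ((τ + x 0 + s₁ * x 2) * (τ + x 0 + s₂ * x 2))) := by
  simp [det_fin_three, Matrix.add_apply]
  ring

/-! ## The stub -/

/-- **Stub Tʰ (Oshime's family (T), homogenised, has size-`3` spectrahedral cones).** For
`s₁ < s₂ < s₃` and `s₁ ≤ b₁ ≤ s₂ ≤ b₂ ≤ s₃` (interlacing), the closed nonnegative-spectrum cone
`{x : ∀ τ > 0, det (x₀·1 + x₁ J₃ + x₂ B + x₃ C + τ·1) ≠ 0}` of the Jordan-block family (T)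
pencil of Oshime (1991, part (II), Prop. 4.6 / Thm. 6.2),
`B = !![0, e₂, −e₃; −1, e₁, 0; 0, 1, 0]`, `C = b₀ · !![0, b₁ + b₂, −b₁ b₂; 0, 1, 0; 0, 0, 0]`,
is a spectrahedron of size `3`: by the real symmetric "diagonal + rank one" certificate
`L x = x₀·1 + x₂ diag (s₁, s₂, s₃) + x₃ b₀ c cᵀ`, `cᵢ = √κᵢ`, one has
`det (P x + τ·1) = det (L x + τ·1)` (F1, F3, F4), and `stub_spectrahedron_of_symmDetIdentity`
applies. [folklore] -/
theorem stub_oshimeFamilyTh_spectrahedron :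
    ∀ s₁ s₂ s₃ b₀ b₁ b₂ : ℝ, s₁ < s₂ → s₂ < s₃ → s₁ ≤ b₁ → b₁ ≤ s₂ → s₂ ≤ b₂ → b₂ ≤ s₃ →
      Literature.AlgebraicGeometry.HyperbolicPolynomials.IsSpectrahedralShadowOfSize
        {x : Fin 4 → ℝ | ∀ τ : ℝ, 0 < τ →
          (x 0 • (1 : Matrix (Fin 3) (Fin 3) ℝ) + x 1 • !![(0 : ℝ), 1, 0; 0, 0, 1; 0, 0, 0] +
            x 2 • !![0, s₁ * s₂ + s₂ * s₃ + s₃ * s₁, -(s₁ * s₂ * s₃); -1, s₁ + s₂ + s₃, 0; 0, 1, 0] +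
            x 3 • !![0, b₀ * (b₁ + b₂), -(b₀ * b₁ * b₂); 0, b₀, 0; 0, 0, 0] +
            τ • (1 : Matrix (Fin 3) (Fin 3) ℝ)).det ≠ 0} 3 := by
  intro s₁ s₂ s₃ b₀ b₁ b₂ h12 h23 hb1 hb1' hb2 hb2'
  -- the Lagrange coefficients `κᵢ ≥ 0` and their square roots `cᵢ`
  obtain ⟨hk1, hk2, hk3⟩ :=
    permanentalCones_oshimeT_kappa_nonneg s₁ s₂ s₃ b₁ b₂ h12 h23 hb1 hb1' hb2 hb2'
  obtain ⟨c₁, hc1⟩ : ∃ c : ℝ, c ^ 2 = (b₁ - s₁) * (b₂ - s₁) / ((s₂ - s₁) * (s₃ - s₁)) :=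
    ⟨_, Real.sq_sqrt hk1⟩
  obtain ⟨c₂, hc2⟩ : ∃ c : ℝ, c ^ 2 = (b₁ - s₂) * (b₂ - s₂) / ((s₁ - s₂) * (s₃ - s₂)) :=
    ⟨_, Real.sq_sqrt hk2⟩
  obtain ⟨c₃, hc3⟩ : ∃ c : ℝ, c ^ 2 = (b₁ - s₃) * (b₂ - s₃) / ((s₁ - s₃) * (s₂ - s₃)) :=
    ⟨_, Real.sq_sqrt hk3⟩
  -- the pencil `P x = x 0 • 1 + x 1 • J₃ + x 2 • B + x 3 • C`
  let P : (Fin 4 → ℝ) →ₗ[ℝ] Matrix (Fin 3) (Fin 3) ℝ := Fintype.linearCombination ℝ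
    ![(1 : Matrix (Fin 3) (Fin 3) ℝ), !![(0 : ℝ), 1, 0; 0, 0, 1; 0, 0, 0],
      !![0, s₁ * s₂ + s₂ * s₃ + s₃ * s₁, -(s₁ * s₂ * s₃); -1, s₁ + s₂ + s₃, 0; 0, 1, 0],
      !![0, b₀ * (b₁ + b₂), -(b₀ * b₁ * b₂); 0, b₀, 0; 0, 0, 0]]
  have hP : ∀ x : Fin 4 → ℝ, P x =
      x 0 • (1 : Matrix (Fin 3) (Fin 3) ℝ) + x 1 • !![(0 : ℝ), 1, 0; 0, 0, 1; 0, 0, 0] +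
        x 2 • !![0, s₁ * s₂ + s₂ * s₃ + s₃ * s₁, -(s₁ * s₂ * s₃); -1, s₁ + s₂ + s₃, 0; 0, 1, 0] +
        x 3 • !![0, b₀ * (b₁ + b₂), -(b₀ * b₁ * b₂); 0, b₀, 0; 0, 0, 0] := fun x => by
    simp only [P, Fintype.linearCombination_apply, Fin.sum_univ_four, Matrix.cons_val_zero,
      Matrix.cons_val_one, Matrix.cons_val_two, Matrix.cons_val_three, Matrix.head_cons,
      Matrix.tail_cons]
  -- the symmetric certificate `L x = x 0 • 1 + x 2 • diag (s₁, s₂, s₃) + x 3 • b₀ c cᵀ`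
  let L : (Fin 4 → ℝ) →ₗ[ℝ] Matrix (Fin 3) (Fin 3) ℝ := Fintype.linearCombination ℝ
    ![(1 : Matrix (Fin 3) (Fin 3) ℝ), 0, !![s₁, 0, 0; 0, s₂, 0; 0, 0, s₃],
      b₀ • !![c₁ * c₁, c₁ * c₂, c₁ * c₃; c₁ * c₂, c₂ * c₂, c₂ * c₃; c₁ * c₃, c₂ * c₃, c₃ * c₃]]
  have hL : ∀ x : Fin 4 → ℝ, L x =
      !![x 0 + s₁ * x 2 + b₀ * (c₁ * c₁) * x 3, b₀ * (c₁ * c₂) * x 3, b₀ * (c₁ * c₃) * x 3;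
        b₀ * (c₁ * c₂) * x 3, x 0 + s₂ * x 2 + b₀ * (c₂ * c₂) * x 3, b₀ * (c₂ * c₃) * x 3;
        b₀ * (c₁ * c₃) * x 3, b₀ * (c₂ * c₃) * x 3, x 0 + s₃ * x 2 + b₀ * (c₃ * c₃) * x 3] :=
    fun x => permanentalCones_oshimeT_L_apply s₁ s₂ s₃ b₀ c₁ c₂ c₃ x
  have hLsymm : ∀ x : Fin 4 → ℝ, (L x).IsSymm := fun x =>
    (hL x).symm ▸ permanentalCones_oshimeT_L_isSymm s₁ s₂ s₃ b₀ c₁ c₂ c₃ x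
  -- the determinantal identity `det (P x + τ·1) = det (L x + τ·1)` (F1, F3, F4)
  have hdet : ∀ (x : Fin 4 → ℝ) (τ : ℝ), (P x + τ • (1 : Matrix (Fin 3) (Fin 3) ℝ)).det =
      (L x + τ • (1 : Matrix (Fin 3) (Fin 3) ℝ)).det := fun x τ => by
    rw [hP, hL, permanentalCones_oshimeT_detP, permanentalCones_oshimeT_detL, hc1, hc2, hc3,
      permanentalCones_oshimeT_lagrange s₁ s₂ s₃ b₁ b₂ h12 h23]
  -- stub S turns the identity into a size-`3` spectrahedral description
  have h := stub_spectrahedron_of_symmDetIdentity 4 3 P L hLsymm hdet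
  simp only [hP] at h
  exact h

end Summit.ValiantsHypothesis.ValiantsHypothesis.Theorems
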